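import Mathlib
import Summits.ValiantsHypothesis.ValiantsHypothesis.Theorems.NewtonUnitEquationsNewtonTauWeakCornerDefs
import Summits.ValiantsHypothesis.ValiantsHypothesis.Theorems.NewtonUnitEquationsNewtonTauWeakK3Defs

/-!
# `NewtonTauWeak` (stmt-ValiantsHypothesis-5904), stub `fixedKCoincidence_t2_K3`: separated products in `ℂ[ℤ²]`

Helper file of the proof of the `K = 3` sub-stub `fixedKCoincidence_t2_K3` of `stub_binomialNewtonTauCommon`
(line `binomial-normal-form`; siege variation "polynomial identity route"), over the Laurent stage of
`…K3Defs.lean` (`Laurent = ℂ[ℤ²]`, monomials `T z`, strict bottoms `IsBot`).  The univariate evaluation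
`U ↦ U(X^{E})` is `Polynomial.aeval (T E) U`; a SEPARATED PRODUCT `Π_e U_e(X^{E_e})` expands over the word box of
`…CornerDefs.lean` (`box`, `push`, `sepCoeff`), its coefficients are fibre sums (`coeff_sepProd`), a rank-two
combination has the coefficients `fibreSum` of the corner model (`coeff_corner_combination`), its bottom is the
corner `0` when the directions weigh positively (`isBot_sepProd_zero`), and evaluations of univariate polynomials
agreeing in low degree agree in low weight (`lowEq_aeval`).  No definitions. [folklore]
-/

set_option linter.dupNamespace false

noncomputable section

namespace Summit.ValiantsHypothesis.ValiantsHypothesis.Theorems.NewtonUnitEquationsNewtonTauWeak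

open scoped BigOperators Polynomial
open Summit.ValiantsHypothesis.ValiantsHypothesis.Theorems.NewtonTauWeakCorner
open Summit.ValiantsHypothesis.ValiantsHypothesis.Theorems.NewtonTauWeakK3

namespace K3Pi

/-! ## Univariate evaluation at a Laurent monomial -/

/-- Evaluation of a univariate polynomial of degree `≤ D` at `X^z`, expanded over `0..D`. [folklore] -/
theorem aeval_T_eq_sum (z : Fin 2 → ℤ) (P : ℂ[X]) {D : ℕ} (hP : P.natDegree ≤ D) :
    Polynomial.aeval (T z) P = ∑ k ∈ Finset.range (D + 1), P.coeff k • T ((k : ℤ) • z) := by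
  conv_lhs => rw [Polynomial.as_sum_range' P (D + 1) (Nat.lt_succ_of_le hP)]
  rw [map_sum]
  refine Finset.sum_congr rfl fun k _ => ?_
  rw [Polynomial.aeval_monomial, T_pow, Algebra.algebraMap_eq_smul_one, smul_mul_assoc, one_mul]

/-- Coefficients of the evaluation at `X^z`, as a sum over the degrees. [folklore] -/
theorem coeff_aeval_T (z : Fin 2 → ℤ) (P : ℂ[X]) (y : Fin 2 → ℤ) :
    (Polynomial.aeval (T z) P).coeff y = ∑ k ∈ Finset.range (P.natDegree + 1), if (k : ℤ) • z = y then P.coeff k else 0 := by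
  classical
  rw [aeval_T_eq_sum z P le_rfl, AddMonoidAlgebra.coeff_sum, Finsupp.finsetSum_apply]
  refine Finset.sum_congr rfl fun k _ => ?_
  rw [coeff_smul, coeff_T]
  split_ifs <;> simp

/-- Every exponent of `P(X^z)` lies on the ray `ℕ • z`, at a degree where `P` has a nonzero coefficient. [folklore] -/
theorem exists_of_coeff_aeval_T_ne_zero (z : Fin 2 → ℤ) (P : ℂ[X])
    {y : Fin 2 → ℤ} (hy : (Polynomial.aeval (T z) P).coeff y ≠ 0) :
    ∃ k : ℕ, (k : ℤ) • z = y ∧ P.coeff k ≠ 0 := by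
  classical
  rw [coeff_aeval_T z] at hy
  obtain ⟨k, -, hk⟩ := Finset.exists_ne_zero_of_sum_ne_zero hy
  by_cases h : (k : ℤ) • z = y
  · rw [if_pos h] at hk
    exact ⟨k, h, hk⟩
  · rw [if_neg h] at hk
    exact absurd rfl hk

/-- **Low-weight agreement of evaluations.** If `P` and `P'` have the same coefficients below degree `K` and
`β ≤ K ⟨w,z⟩` with `⟨w,z⟩ > 0`, then `P(X^z)` and `P'(X^z)` have the same coefficients at every exponent of
weight `< β`. [folklore] -/
theorem lowEq_aeval (w : Fin 2 → ℝ) (z : Fin 2 → ℤ) (hz : 0 < wt w z) (P P' : ℂ[X]) (K : ℕ) {β : ℝ}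
    (hPP : ∀ k, k < K → P.coeff k = P'.coeff k) (hβ : β ≤ (K : ℝ) * wt w z) :
    ∀ y, wt w y < β → (Polynomial.aeval (T z) P).coeff y = (Polynomial.aeval (T z) P').coeff y := by
  classical
  intro y hy
  -- both sides as sums over a common range
  set D := max P.natDegree P'.natDegree with hD
  have key : ∀ Q : ℂ[X], Q.natDegree ≤ D →
      (Polynomial.aeval (T z) Q).coeff y = ∑ k ∈ Finset.range (D + 1), if (k : ℤ) • z = y then Q.coeff k else 0 := by
    intro Q hQ
    rw [aeval_T_eq_sum z Q hQ, AddMonoidAlgebra.coeff_sum, Finsupp.finsetSum_apply]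
    refine Finset.sum_congr rfl fun k _ => ?_
    rw [coeff_smul, coeff_T]
    split_ifs <;> simp
  rw [key P (le_max_left _ _), key P' (le_max_right _ _)]
  refine Finset.sum_congr rfl fun k _ => ?_
  by_cases h : (k : ℤ) • z = y
  · rw [if_pos h, if_pos h]
    by_cases hk : k < K
    · exact hPP k hk
    · exfalso
      push Not at hk
      have hwy : wt w y = (k : ℝ) * wt w z := by rw [← h, wt_zsmul]; push_cast; ring
      have : (K : ℝ) * wt w z ≤ (k : ℝ) * wt w z := mul_le_mul_of_nonneg_right (by exact_mod_cast hk) hz.le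
      linarith
  · rw [if_neg h, if_neg h]

/-- Exponents of `P(X^z)` weigh nonnegatively when `⟨w,z⟩ > 0`. [folklore] -/
theorem nonneg_aeval (w : Fin 2 → ℝ) (z : Fin 2 → ℤ) (hz : 0 < wt w z) (P : ℂ[X]) :
    ∀ y, (Polynomial.aeval (T z) P).coeff y ≠ 0 → 0 ≤ wt w y := by
  intro y hy
  obtain ⟨k, rfl, -⟩ := exists_of_coeff_aeval_T_ne_zero z P hy
  rw [wt_zsmul]
  exact mul_nonneg (by exact_mod_cast Nat.zero_le k) hz.le

/-! ## Separated products over the word box -/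

/-- **Word expansion of a separated product**: `Π_e U_e(X^{E_e}) = Σ_{n ∈ box} [Π_e [s^{n_e}]U_e] · X^{push n}`.
[folklore] -/
theorem sepProd_eq_sum {s D : ℕ} (E : Fin s → Fin 2 → ℤ) (U : Fin s → ℂ[X]) (hU : ∀ e, (U e).natDegree ≤ D) :
    ∏ e, Polynomial.aeval (T (E e)) (U e) = ∑ n ∈ box s D, sepCoeff U n • T (push E n) := by
  have h : ∏ e, Polynomial.aeval (T (E e)) (U e) =
      ∏ e, ∑ k ∈ Finset.range (D + 1), (U e).coeff k • T ((k : ℤ) • E e) :=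
    Finset.prod_congr rfl fun e _ => aeval_T_eq_sum (E e) (U e) (hU e)
  rw [h, Finset.prod_univ_sum]
  refine Finset.sum_congr rfl fun n _ => ?_
  have hT : ∀ e, (U e).coeff (n e) • T ((n e : ℤ) • E e) =
      AddMonoidAlgebra.single ((n e : ℤ) • E e) ((U e).coeff (n e)) := by
    intro e
    rw [T, AddMonoidAlgebra.smul_single, smul_eq_mul, mul_one]
  simp_rw [hT]
  rw [AddMonoidAlgebra.prod_single, T, AddMonoidAlgebra.smul_single, smul_eq_mul, mul_one]
  rfl

/-- **Coefficients of a separated product are fibre sums over the word box.** [folklore] -/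
theorem coeff_sepProd {s D : ℕ} (E : Fin s → Fin 2 → ℤ) (U : Fin s → ℂ[X]) (hU : ∀ e, (U e).natDegree ≤ D)
    (z : Fin 2 → ℤ) :
    (∏ e, Polynomial.aeval (T (E e)) (U e)).coeff z = ∑ n ∈ (box s D).filter (fun n => push E n = z), sepCoeff U n := by
  classical
  rw [sepProd_eq_sum E U hU, AddMonoidAlgebra.coeff_sum, Finsupp.finsetSum_apply, Finset.sum_filter]
  refine Finset.sum_congr rfl fun n _ => ?_
  rw [coeff_smul, coeff_T]
  split_ifs <;> simp

/-- Every exponent of a separated product is a pushed word of the box with nonzero separated coefficient.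
[folklore] -/
theorem exists_word_of_coeff_sepProd_ne_zero {s D : ℕ} (E : Fin s → Fin 2 → ℤ) (U : Fin s → ℂ[X])
    (hU : ∀ e, (U e).natDegree ≤ D) {z : Fin 2 → ℤ} (hz : (∏ e, Polynomial.aeval (T (E e)) (U e)).coeff z ≠ 0) :
    ∃ n ∈ box s D, push E n = z ∧ sepCoeff U n ≠ 0 := by
  classical
  rw [coeff_sepProd E U hU] at hz
  obtain ⟨n, hn, hne⟩ := Finset.exists_ne_zero_of_sum_ne_zero hz
  exact ⟨n, (Finset.mem_filter.mp hn).1, (Finset.mem_filter.mp hn).2, hne⟩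

/-- Weights of pushed words are nonnegative when all directions weigh positively, and vanish only for the
empty word. [folklore] -/
theorem wt_push_nonneg {s : ℕ} (E : Fin s → Fin 2 → ℤ) (w : Fin 2 → ℝ) (hw : ∀ e, 0 < wt w (E e))
    (n : Fin s → ℕ) : 0 ≤ wt w (push E n) ∧ (wt w (push E n) = 0 → n = 0) := by
  rw [wt_push]
  have hle : ∀ e, 0 ≤ (n e : ℝ) * wt w (E e) := fun e => mul_nonneg (Nat.cast_nonneg _) (hw e).le
  refine ⟨Finset.sum_nonneg fun e _ => hle e, fun h => ?_⟩
  have h0 := (Finset.sum_eq_zero_iff_of_nonneg fun e _ => hle e).mp h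
  funext e
  have := h0 e (Finset.mem_univ e)
  rcases mul_eq_zero.mp this with h1 | h1
  · exact_mod_cast h1
  · exact absurd h1 (hw e).ne'

/-- Exponents of a separated product weigh nonnegatively (directions of positive weight). [folklore] -/
theorem nonneg_sepProd {s D : ℕ} (E : Fin s → Fin 2 → ℤ) (w : Fin 2 → ℝ) (hw : ∀ e, 0 < wt w (E e))
    (U : Fin s → ℂ[X]) (hU : ∀ e, (U e).natDegree ≤ D) :
    ∀ z, (∏ e, Polynomial.aeval (T (E e)) (U e)).coeff z ≠ 0 → 0 ≤ wt w z := by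
  intro z hz
  obtain ⟨n, -, rfl, -⟩ := exists_word_of_coeff_sepProd_ne_zero E U hU hz
  exact (wt_push_nonneg E w hw n).1

/-- The constant coefficient of a separated product is the product of the constant coefficients (directions of
positive weight). [folklore] -/
theorem coeff_sepProd_zero {s D : ℕ} (E : Fin s → Fin 2 → ℤ) (w : Fin 2 → ℝ) (hw : ∀ e, 0 < wt w (E e))
    (U : Fin s → ℂ[X]) (hU : ∀ e, (U e).natDegree ≤ D) :
    (∏ e, Polynomial.aeval (T (E e)) (U e)).coeff 0 = ∏ e, (U e).coeff 0 := by
  classical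
  rw [coeff_sepProd E U hU, Finset.sum_eq_single_of_mem (0 : Fin s → ℕ)]
  · rfl
  · refine Finset.mem_filter.mpr ⟨?_, by simp [push]⟩
    unfold box
    exact Fintype.mem_piFinset.mpr fun _ => Finset.mem_range.mpr (Nat.succ_pos D)
  · intro n hn hn0
    exfalso
    have hp : push E n = 0 := (Finset.mem_filter.mp hn).2
    exact hn0 ((wt_push_nonneg E w hw n).2 (by rw [hp, wt_zero]))

/-- **The corner of a separated product**: if every direction weighs positively and the constant coefficient is
nonzero, the origin is the strict bottom. [folklore] -/
theorem isBot_sepProd_zero {s D : ℕ} (E : Fin s → Fin 2 → ℤ) (w : Fin 2 → ℝ) (hw : ∀ e, 0 < wt w (E e))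
    (U : Fin s → ℂ[X]) (hU : ∀ e, (U e).natDegree ≤ D) (hU0 : ∀ e, (U e).coeff 0 ≠ 0) :
    IsBot w (∏ e, Polynomial.aeval (T (E e)) (U e)) 0 := by
  refine ⟨?_, fun z hz hne => ?_⟩
  · rw [coeff_sepProd_zero E w hw U hU]
    exact Finset.prod_ne_zero_iff.mpr fun e _ => hU0 e
  · obtain ⟨n, -, hpush, -⟩ := exists_word_of_coeff_sepProd_ne_zero E U hU hz
    rw [← hpush, wt_zero]
    have h := wt_push_nonneg E w hw n
    refine lt_of_le_of_ne h.1 fun h0 => hne ?_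
    rw [← hpush, h.2 h0.symm]
    simp [push]

/-- **Bridge to the corner model.** The coefficients of `κ₁ Π_e U_e(X^{E_e}) + κ₂ Π_e W_e(X^{E_e})` are the
fibre sums `fibreSum E D κ₁ κ₂ U W` of `NewtonTauWeakCorner`. [folklore] -/
theorem coeff_corner_combination {s D : ℕ} (E : Fin s → Fin 2 → ℤ) (κ₁ κ₂ : ℂ) (U W : Fin s → ℂ[X])
    (hU : ∀ e, (U e).natDegree ≤ D) (hW : ∀ e, (W e).natDegree ≤ D) (z : Fin 2 → ℤ) :
    (κ₁ • ∏ e, Polynomial.aeval (T (E e)) (U e) + κ₂ • ∏ e, Polynomial.aeval (T (E e)) (W e)).coeff z =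
      fibreSum E D κ₁ κ₂ U W z := by
  classical
  rw [AddMonoidAlgebra.coeff_add, Finsupp.add_apply, coeff_smul, coeff_smul, coeff_sepProd E U hU,
    coeff_sepProd E W hW]
  unfold fibreSum
  rw [Finset.sum_add_distrib, Finset.mul_sum, Finset.mul_sum]

/-! ## Two more facts on strict bottoms -/

/-- Removing a summand all of whose exponents are strictly heavier than the bottom. [folklore] -/
theorem isBot_of_isBot_add {w : Fin 2 → ℝ} {F G : Laurent} {v : Fin 2 → ℤ} (h : IsBot w (F + G) v)
    (hG : ∀ z, G.coeff z ≠ 0 → wt w v < wt w z) : IsBot w F v := by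
  have hF : F = (F + G) + (-G) := by abel
  rw [hF]
  refine h.add_of_forall_lt fun z hz => hG z ?_
  rwa [AddMonoidAlgebra.coeff_neg, Finsupp.neg_apply, neg_ne_zero] at hz

/-- The bottom of `c • 1 + G` is the origin when `c ≠ 0` and `G` only has exponents of positive weight.
[folklore] -/
theorem isBot_smul_one_add {w : Fin 2 → ℝ} {G : Laurent} {c : ℂ} (hc : c ≠ 0)
    (hG : ∀ z, G.coeff z ≠ 0 → 0 < wt w z) : IsBot w (c • (1 : Laurent) + G) 0 := by
  have h1 : IsBot w (c • (1 : Laurent)) 0 := by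
    have : (c • (1 : Laurent)) = c • T 0 := by rw [T_zero]
    rw [this]
    refine IsBot.smul ?_ hc
    refine ⟨by rw [coeff_T, if_pos rfl]; exact one_ne_zero, fun z hz hne => ?_⟩
    rw [coeff_T] at hz
    split_ifs at hz with h
    · exact absurd h.symm hne
    · exact absurd rfl hz
  refine h1.add_of_forall_lt fun z hz => ?_
  rw [wt_zero]
  exact hG z hz

end K3Pi

end Summit.ValiantsHypothesis.ValiantsHypothesis.Theorems.NewtonUnitEquationsNewtonTauWeak

end
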